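import Literature.NumberTheory.Automorphic.Liu2021.Def411WeilCarriersAtLine
import Literature.NumberTheory.Automorphic.Liu2021.Def411WeilCarriersDoubling
import HarnessLib

/-!
# [Liu2021, Def. 4.11]'s finite-adelic oscillator representation `ω(μ, ε, χ)_f` realised at a line `⟨a⟩` depends only on the FINITE
# local norm classes of `a` — the LINE-CLASS TRANSPORT letter (C′) of the floor-0 programme P2

Topic `NumberTheory/Automorphic/Liu2021`; namespace `Literature.NumberTheory.Automorphic.Liu2021.Def411WeilCarriers`.  STATEMENT-ONLY: one
closed named fact `def rhoAtLine_lineClassTransport : Prop` (no `sorry`, no instance, no notation); imports = tree: ★ `Def411WeilCarriersAtLine`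
(`rhoAtLine`, `locF`, `TW`, `JW`) and ★ `Def411WeilCarriersDoubling` (`chiSplittingLine` ∕ `isCompatible_chiSplittingLine`: the compatible splitting
of the dual pair `U(diag dV) × U(⟨a⟩)` ATTACHED TO A SPLITTING CHARACTER `χ_V` of `L`, [HarrisKudlaSweet1996, §1]; [Liu2021, App. D Step 2]'s `ι_μ`).

WHY (F0P2-plan (g0) RULING 2026-08-30T22:16Z, on F0P2-p02's finding 22:11Z).  The tree realises `ω(μ, ε, χ)` at a REPRESENTATIVE line `⟨a⟩`,
`a ∈ (L⁺)ˣ` with `locF a = ε` (`omegaAtLine` ∕ `rhoAtLine`; the crux pin of the Hodge programme reads it at `a := r ε` for a faithful section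
`r : Rep`, i.e. at `lineOf ε = Classical.choose …` off one re-pointed class).  The collections `ε ∈ Eps L⁺ d` record the norm classes
`a · Nm_{L_v/L⁺_v} L_v^×` at the FINITE places `v` only ([Liu2021, Def. 4.11 second bullet; Def. 4.12]: «for every nonarchimedean place»), so two
representatives `a, a′` of the same `ε` agree locally at every finite place but NOT necessarily at the real places of `L⁺` (class field theory for the
CM quadratic extension `L/L⁺`: there are `t ∈ (L⁺)ˣ` that are local norms at all finite places and negative at an even number ≥ 2 of real places),
and then the hermitian LINES `⟨a⟩`, `⟨a′⟩` are not rationally isometric (Hasse needs all places).  What the programme needs — and what is true — is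
that the FINITE-ADELIC representations agree: `ω(μ, ε_a, χ)_f ≅ ω(μ, ε_{a′}, χ)_f` as representations of `U(V)(𝔸_{L⁺,f})` whenever
`locF a = locF a′`.  This letter records that statement (an INJECTIVE intertwiner suffices for every consumer: injective ∘ injective).

THE LETTER `rhoAtLine_lineClassTransport` (CLASS **U** — a READING; chain): for `L` CM, a real non-zero diagonal frame `dV` of an
`N′`-dimensional hermitian space, a unitary Hecke character `χ_V` of `L` satisfying the splitting condition for `dim W = 1` ([HarrisKudlaSweet1996,
(1.5)]), any group `G` mapping to `U(diag dV)(𝔸_{L⁺,f})` (`ιV`), any `χ ∈ Chi`, and `a, a′ ∈ (L⁺)ˣ` with the same finite local norm classes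
(`locF L⁺ d a = locF L⁺ d a′`, `d = imagUnitSq L`): there is an injective `G`-intertwiner
`rhoAtLine … (χ_V-splittings) ιV a χ ↪ rhoAtLine … (χ_V-splittings) ιV a′ χ`.
READING.  (1) Rank-one hermitian spaces over `L_v/L⁺_v` are classified by the norm class of a Gram entry: `⟨a⟩_v ≅ ⟨a′⟩_v` iff
`a/a′ ∈ Nm L_v^×` ([Jacobowitz1962, Thm. 3.1]; [Liu2021, App. D §D.1 Step 1 and its footnote, l. 5215: «the isomorphism class of `ω(μ, ε, χ)` depends
only on `(μ, ε, χ)`»]).  (2) The local Weil representation of the dual pair `U(V_v) × U(W_v)` at the splittings attached to a pair of characters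
`(χ_V, χ_W)` is functorial in isometries `W_v → W′_v` (transport of structure through the Heisenberg group and the Schrödinger model; the
`χ`-splittings of [HarrisKudlaSweet1996, §1 (1.14)–(1.15)] ∕ [Kudla1994, §1–3, Thm. 3.1] are defined intrinsically, hence transported to each other)
([MVW1987, Ch. 3 §I]; [Kudla1994, §1–3]); the unitary groups `U(⟨a⟩) = U(⟨a′⟩) = L¹` coincide as subgroups of `L^×` and the isometry `w ↦ z_v w`
(`Nm z_v = a′/a`) induces the identity on them, so the `χ_W`-coinvariants ([GelbartRogawski1991, §3.1–3.2]) correspond.  (3) Restricted tensor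
product functoriality over the finite places ([Flath1979, §2]): the finite-adelic representation `⊗'_{v<∞} ω_v` of `U(V)(𝔸_{L⁺,f})`, and its
pull-back along any `ιV`, are isomorphic for `a` and `a′`.  This is reading (5) of ★ `Rogawski1990.cohFinComponent_isTheta`'s docstring, isolated as a
socket.  The in-tree proof (transport of `finPairRepW` along a finite-adelic similitude `z_f ∈ 𝔸_{L,f}^×` with `Nm z_f = a′/a` and naturality of the
`χ_V`-splitting) is a separate rung item; nothing of it is asserted here as a theorem.  NOT CLAIMED: anything for an ARBITRARY compatible
splitting family (false: twisting one member by `ν ∘ det` changes the isomorphism class) — the splittings are the `χ_V`-splittings at both lines.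
HC_CM is proved only modulo the printed citations until rung 0 closes.

## References
* [Liu2021] Y. Liu, *Fourier–Jacobi cycles and arithmetic relative trace formula*, Camb. J. Math. 9 (2021) = arXiv:2102.11518: Def. 4.11 (l. 2083–2097),
  Def. 4.12 (l. 2102–2108), App. D §D.1 Step 1 with footnote (l. 5215), Steps 2–3 (l. 5217–5221).
* [Jacobowitz1962] R. Jacobowitz, *Hermitian forms over local fields*, Amer. J. Math. 84 (1962), Thm. 3.1.
* [MVW1987] C. Mœglin, M.-F. Vignéras, J.-L. Waldspurger, *Correspondances de Howe sur un corps p-adique*, LNM 1291 (1987), Ch. 3 §I.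
* [Kudla1994] S. Kudla, *Splitting metaplectic covers of dual reductive pairs*, Israel J. Math. 87 (1994), §1–3, Thm. 3.1.
* [HarrisKudlaSweet1996] M. Harris, S. Kudla, W. Sweet, J. AMS 9 (1996), §1 (1.5), (1.14)–(1.15).
* [GelbartRogawski1991] S. Gelbart, J. Rogawski, Invent. Math. 105 (1991), §3.1–3.2 (pp. 454–457).
* [Flath1979] D. Flath, *Decomposition of representations into tensor products*, Corvallis PSPM 33.1 (1979), §2.
-/

noncomputable section

open NumberField IsDedekindDomain
open scoped Matrix

namespace Literature.NumberTheory.Automorphic.Liu2021.Def411WeilCarriers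

open Literature.NumberTheory.Automorphic Literature.NumberTheory.Automorphic.UnitaryGroup
open Literature.NumberTheory.Automorphic.Liu2021.Def411WeilCarriersDoubling
open Literature.NumberTheory.GelbartRogawski1991 Literature.NumberTheory.GelbartRogawski1991.UnitaryDualPair
open Literature.RepresentationTheory.HarrisKudlaSweet1996
open Literature.NumberTheory.GaloisRepresentations (HeckeCharacter)

/-- **U** (C′) **`ω(μ, ε, χ)_f` at a line depends only on the finite local norm classes of the line.**  For `L` CM, a real non-zero
diagonal frame `dV : Fin N′ → L`, a unitary Hecke character `χ_V` of `L` with the splitting condition for `dim W = 1`, a homomorphism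
`ιV : G →* U(diag dV)(𝔸_{L⁺,f})`, a character `χ ∈ Chi`, and two lines `a, a′ ∈ (L⁺)ˣ` with `locF L⁺ (imagUnitSq L) a = locF L⁺ (imagUnitSq L) a′`
(the same norm class at EVERY FINITE place): the `G`-representation `rhoAtLine … ιV a χ` — the `χ`-coinvariants of the finite Weil representation of
`U(diag dV) × U(⟨a⟩)` at the `χ_V`-splitting (`isCompatible_chiSplittingLine`), pulled back along `ιV` — embeds `G`-equivariantly into
`rhoAtLine … ιV a′ χ` (indeed they are isomorphic).  READING (module docstring (1)–(3)): [Jacobowitz1962, Thm. 3.1] (rank-one hermitian lines over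
`L_v/L⁺_v` ↔ norm classes) ∘ [MVW1987, Ch. 3 §I], [Kudla1994, §1–3], [HarrisKudlaSweet1996, §1] (local Weil representation at the `χ`-splittings is
functorial in isometries of `W_v`; `U(⟨a⟩) = U(⟨a′⟩) = L¹`) ∘ [GelbartRogawski1991, §3.1–3.2] (`χ_W`-coinvariants) ∘ [Flath1979, §2] (restricted
tensor product over `v < ∞`); = [Liu2021, App. D §D.1 Step 1 footnote l. 5215].
[cite: Liu2021, Def. 4.11; Def. 4.12; App. D §D.1 Step 1 footnote (l. 5215), Steps 2–3] [cite: Jacobowitz1962, Thm. 3.1]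
[cite: MVW1987, Ch. 3 §I] [cite: Kudla1994, §1–3, Thm. 3.1] [cite: HarrisKudlaSweet1996, §1 (1.5), (1.14)–(1.15)]
[cite: GelbartRogawski1991, §3.1–3.2 pp. 454–457] [cite: Flath1979, §2] -/
def rhoAtLine_lineClassTransport : Prop :=
  ∀ (L : Type) [Field L] [NumberField L] [IsCMField L] {N' n' : ℕ} (e₁ : Fin N' × Fin 1 ≃ Fin n')
    (dV : Fin N' → L) (hdV : ∀ i, IsCMField.complexConj L (dV i) = dV i) (hdV0 : ∀ i, dV i ≠ 0)
    (χV : HeckeCharacter L) (hχu : χV.IsUnitary) (hχs : IsSplittingChar L 1 χV)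
    {G : Type} [Group G] [TopologicalSpace G]
    (ιV : G →* finAdelic (↥(maximalRealSubfield L)) L (IsCMField.complexConj L) N' (Matrix.diagonal dV))
    (χ : Chi (↥(maximalRealSubfield L)) L (IsCMField.complexConj L))
    (a a' : (↥(maximalRealSubfield L))ˣ),
    locF (↥(maximalRealSubfield L)) (imagUnitSq L) a = locF (↥(maximalRealSubfield L)) (imagUnitSq L) a' →
      ∃ e : (rhoAtLine (↥(maximalRealSubfield L)) L (IsCMField.complexConj L) N' e₁ (Matrix.diagonal dV)
              (complexConj_imagUnit L) (imagUnit_ne_zero L) (imagUnit_mul_self L) (realDiagonal_isSymm L dV hdV)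
              (isUnit_det_realDiagonal L dV hdV hdV0) (realDiagonal_map L dV hdV).symm
              (fun b => isCompatible_chiSplittingLine L e₁ dV hdV hdV0 χV hχu hχs
                (TW (↥(maximalRealSubfield L)) b) (isSymm_TW (↥(maximalRealSubfield L)) b)
                (isUnit_det_TW (↥(maximalRealSubfield L)) b) (JW (↥(maximalRealSubfield L)) L b)
                (JW_eq (↥(maximalRealSubfield L)) L b))
              ιV a χ).IntertwiningMap
            (rhoAtLine (↥(maximalRealSubfield L)) L (IsCMField.complexConj L) N' e₁ (Matrix.diagonal dV)
              (complexConj_imagUnit L) (imagUnit_ne_zero L) (imagUnit_mul_self L) (realDiagonal_isSymm L dV hdV)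
              (isUnit_det_realDiagonal L dV hdV hdV0) (realDiagonal_map L dV hdV).symm
              (fun b => isCompatible_chiSplittingLine L e₁ dV hdV hdV0 χV hχu hχs
                (TW (↥(maximalRealSubfield L)) b) (isSymm_TW (↥(maximalRealSubfield L)) b)
                (isUnit_det_TW (↥(maximalRealSubfield L)) b) (JW (↥(maximalRealSubfield L)) L b)
                (JW_eq (↥(maximalRealSubfield L)) L b))
              ιV a' χ),
        Function.Injective e

end Literature.NumberTheory.Automorphic.Liu2021.Def411WeilCarriers

end
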